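/-
Copyright: the b2b-balaban T⁴-continuum CRUX team, row NE7b OWNER lineage `t4-ne7b-p1` (gen 121). Project licence.
-/
import Summits.QuantumFields.BalabanUV.T4Continuum.Spine.NE7b.SupTorusPropagatorLocality

/-!
# THE FLUCTUATION COVARIANCE `C = H⁻¹ − H⁻¹Q′t*T⁻¹Q′tH⁻¹` OF THE TORUS ROAD IS EXPONENTIALLY LOCAL BLOCK-TO-BLOCK IN `ℓ²` — given the
# coarse floor, and UNCONDITIONALLY on the two-sided class `−λ ≤ V ≤ Λ`: for `H = (n+1)²(−Δ) + a(n+1)^{−d}(block sums) + V`, `T = Q′tH⁻¹Q′t*`,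
# a source `f` supported in ONE block `y₀` has `Σ_{B_y}(Cf)² ≤ C·e^{−2δρ_s(y,y₀)}·Σf²` over EVERY block `y`, and `Cf` has ZERO block means —
# `(C, δ)` from `(d, a, λ, Λ)` ONLY; § [NE7bP1-G120-HANDOFF-FINAL] NEXT «the covariance ((137) twice)» DONE (row NE7b; (131)–(138) BY NAME; [folklore])

Cell `pub-balaban`, sub-cell `t4`, spine estimate NE7b (`T4WeightBudget.RelWeightBound`; the cell's OWN estimate — NOT PRINTED in
[Bałaban 1983–89], NOT PROVED).  Crux-route work under `Spine/NE7b/` by the row OWNER (`t4-ne7b-p1` gen 121, file (139)) under FREEZE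
(0)'s crux-prover clause; NOTHING of Bałaban's is named as a Lean object, valued or asserted; no `T4Continuum/Support` leaf typed; no `def`,
no notation (`H⁻¹f` enters as `u` with the display `Hu = f`; the coarse coefficients `M(Q′tu)`, the response part `Σ_{y′}c y′ψ_{y′}` and the
fluctuation part `u − h` are WRITTEN OUT; `T⁻¹` is Mathlib's inverse of `Matrix.of T`); zero `sorry`.  Imports (BY NAME): the OWNER's (138)
`…SupTorusPropagatorLocality` (`coarse_convolution_le`, `blockSq_le_of_block_source`, `blockMean_le_of_block_source`; through it (137)
`rate_mono`, `blockSq_le_of_decaying_source`, (135) `coarse_floor`, (134) `schur_inverse_decay`, (133) `action_sum_smul`, (131) `exists_rate`),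
Mathlib's `Matrix.mul_nonsing_inv`, `Matrix.mulVec_injective_iff_isUnit`.

WHY (located).  `Cf = u − h` with `u = H⁻¹f`, `h = H⁻¹Q′t*c`, `c = T⁻¹(Q′tu)`: (138) localises `u` block-to-block and its block means `Q′tu`
at the block-RMS size `√((n+1)^{−d}Σf²)`; (134) localises `T⁻¹` given the floor; (138) `coarse_convolution_le` makes `c` an exponentially
decaying coarse profile of that size; (137) `blockSq_le_of_decaying_source` reads `h = H⁻¹(c∘bt)` in block `ℓ²` with the block volume
`(n+1)^d` — which the squared block-RMS size cancels EXACTLY; `(u − h)² ≤ 2u² + 2h²`.  Rates: `κ₀` of (131) `exists_rate` for `u`, `(c₁, δ₁)` of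
(134), `δ = min(δ₁, κ₀∕2)` for the convolution, `κ′ = δ∕2` for `h` (floors `≥ (min(2,a) − λ)∕2` by (137) `rate_mono`).  Zero block means:
`Q′th = T·T⁻¹·(Q′tu) = Q′tu` by exchanging finite sums, `T·T⁻¹ = 1` since the floor makes `T.mulVec` injective.  On the two-sided class the
floor is (135) `coarse_floor`.  This is the covariance of the Gaussian part of the fluctuation integral at a background — the input for
per-block (cluster ∕ cumulant) control of g119's Laplace sandwich (116)∕(117), § NEXT (3)(d).

WHAT IS PROVED ([folklore]; fine torus `Site d ((n+1)s)`, coarse `Site d s`, `[NeZero s]`; the action DISPLAYED; `bt x = σ_s(blk n (wm x))`;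
`m_κ = min(2,a) − λ − 2dκ² − a(e^{2dκ} − 1)`; `ρ_s` = (132)'s distance written out; `K_δ = (2∕(1 − e^{−δ}))^d`; for a coarse kernel `M`:
`c y′ = Σ_{y″}M y′ y″·(n+1)^{−d}Σ_z u(σ(chart (wm y″) z))`, `h = Σ_{y′}c y′·ψ_{y′}`, columns `Hψ_{y′} = 𝟙[bt · = y′]`):
* §1 **`blockMean_response_eq`** (`Σ_{y′}T(y,y′)M y′ y″ = δ_{yy″}` ⟹ `Q′th = Q′tu`),
  **`coeff_le`** (`|M y′ y″| ≤ c₁e^{−δ₁ρ_s}`, `Hu = f`, `f` in the block `y₀`, `δ ≤ δ₁`, `2δ ≤ κ` ⟹ `|c y′| ≤ c₁m_κ⁻¹e^{2dκ}√((n+1)^{−d}Σf²)K_δ·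
  e^{−δρ_s(y′,y₀)}`), **`response_blockSq_le`** (`2κ′ ≤ δ` ⟹ `Σ_z h(σ(chart (wm y) z))² ≤ m_{κ′}⁻²m_κ⁻²c₁²e^{4dκ}e^{4dκ′}K_δ³·e^{−2κ′ρ_s(y,y₀)}Σf²`),
  **`fluctuation_blockSq_le`** (`Σ_z (u − h)(σ(chart (wm y) z))² ≤ 2(m_κ⁻²e^{4dκ} + m_{κ′}⁻²m_κ⁻²c₁²e^{4dκ}e^{4dκ′}K_δ³)·e^{−2κ′ρ_s(y,y₀)}Σf²`).
* §2 `det_isUnit_of_floor`; **`covariance_local_of_floor`** (`a ≥ 0`, `λ < min(2,a)`, `γ > 0`: `∃ C δ > 0` such that for ALL `n, s, V ≥ −λ, ψ`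
  WITH the floor `γΣg² ≤ ⟨g,Tg⟩`, every `y₀`, every `Hu = f` with `f` in the block `y₀`, `M = T⁻¹`: (i) `Σ_z u(σ(chart (wm y) z))² ≤ Ce^{−2δρ_s(y,y₀)}Σf²`;
  (ii) `(n+1)^{−d}Σ_z (u − h)(σ(chart (wm y) z)) = 0`; (iii) `Σ_z (u − h)(σ(chart (wm y) z))² ≤ Ce^{−2δρ_s(y,y₀)}Σf²` — every block `y`); THE HEADLINE
  **`covariance_local`** (the same UNCONDITIONALLY for `a > 0`, `−λ ≤ V ≤ Λ`, constants from `(d, a, λ, Λ)` only).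
* §3 toy.

HONEST (what this is NOT).  Block-`ℓ²` operator-norm currency, sources in one block (general `f` by linearity); not pointwise (no `ℓ^∞`
theory, § NEXT (3)(b) untouched); the identification of `u − h` with the road's fluctuation covariance applied to `f` is by the displays
(`Q′t(u − h) = 0`, `H(u − h) = f − c∘bt`) — (100)∕(102)'s operator is not re-typed; constants explicit, far from sharp; cubic periods; scalar
skeleton ((A3), NC-NE7b-α UNRULED); nothing of the covariant propagators; nothing of Bałaban's.  BY-NAME EFFECT ON THE WALL: NONE.  NE7b NOT
PRINTED ∕ NOT PROVED; spine PROVED 0∕9; rung (B)+1 on a FINITE torus — NOT infinite volume, NOT the mass gap, NOT Clay.  HONEST DEPENDENCY: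
continuum YM on T⁴ ⇐ BetaPertH ∧ nine spine estimates (0∕9 proved); BetaPertH ⇐ (D1) ∧ (D4) ∧ CAP+tail; G-an2-4 gates asym, D1 and NE2∕3∕4.
-/

set_option autoImplicit false

noncomputable section

namespace Summit.QuantumFields.BalabanUV.T4Continuum.NE7b.SupTorusCovarianceLocality

open Real
open Literature.MathematicalPhysics.QuantumFieldTheory.Balaban1983to89
open B6QGQLower276 (X e blk B side chart mem_B sum_B sum_B_const card_cube blk_chart)
open Beta (Site siteOf windowMap siteOf_windowMap siteOf_add)
open SupTorusHessianCombesThomas (exists_rate)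
open SupTorusActionForm (action_sum_smul)
open SupTorusSchurComplement (schur_inverse_decay)
open SupTorusCoarseFloor (coarse_floor)
open SupTorusResponseLocality (rate_mono blockSq_le_of_decaying_source)
open SupTorusPropagatorLocality (coarse_convolution_le blockSq_le_of_block_source blockMean_le_of_block_source)

variable {d : ℕ}

/-! ## §1. The response part `H⁻¹Q′t*M(Q′tu)` and the fluctuation part `u − H⁻¹Q′t*M(Q′tu)` of `u = H⁻¹f`, `f` in one block -/

section Fluctuation

variable (n : ℕ) (a : ℝ) (s : ℕ) [NeZero s] (V : Site d ((n + 1) * s) → ℝ)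
  (ψ : Site d s → Site d ((n + 1) * s) → ℝ)
  (hψ : ∀ y' x, ((n : ℝ) + 1) ^ 2 * ∑ μ, (2 * ψ y' x - ψ y' (x + siteOf d ((n + 1) * s) (e μ)) - ψ y' (x - siteOf d ((n + 1) * s) (e μ)))
      + a / ((n : ℝ) + 1) ^ d * ∑ q ∈ B n (blk n (windowMap d ((n + 1) * s) x)), ψ y' (siteOf d ((n + 1) * s) q) + V x * ψ y' x
      = if siteOf d s (blk n (windowMap d ((n + 1) * s) x)) = y' then 1 else 0)
  (Minv : Site d s → Site d s → ℝ) (u : Site d ((n + 1) * s) → ℝ)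

/-- **THE RESPONSE PART HAS THE SAME BLOCK MEANS AS `u`** when `M` is a right inverse of the Schur complement
`T(y,y′) = (n+1)^{−d}Σ_z ψ_{y′}(σ(chart (wm y) z))`: with `c = M(Q′t u)` (coarse coefficients `c y′ = Σ_{y″} M y′ y″·(n+1)^{−d}Σ_{z} u(σ(chart (wm y″) z))`)
and `h = Σ_{y′} c y′·ψ_{y′}`, `Q′t h = T·M·(Q′t u) = Q′t u` — so the fluctuation part `u − h` has ZERO block means. [folklore] -/
theorem blockMean_response_eq
    (hTM : ∀ y y'' : Site d s, ∑ y', ((((n : ℝ) + 1) ^ d)⁻¹ * ∑ z : Fin d → Fin (n + 1), ψ y' (siteOf d ((n + 1) * s) (chart n (windowMap d s y) z)))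
      * Minv y' y'' = if y = y'' then 1 else 0) (y : Site d s) :
    (((n : ℝ) + 1) ^ d)⁻¹ * ∑ z : Fin d → Fin (n + 1), (∑ y', (∑ y'', Minv y' y''
        * ((((n : ℝ) + 1) ^ d)⁻¹ * ∑ z'' : Fin d → Fin (n + 1), u (siteOf d ((n + 1) * s) (chart n (windowMap d s y'') z''))))
        * ψ y' (siteOf d ((n + 1) * s) (chart n (windowMap d s y) z)))
      = (((n : ℝ) + 1) ^ d)⁻¹ * ∑ z : Fin d → Fin (n + 1), u (siteOf d ((n + 1) * s) (chart n (windowMap d s y) z)) := by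
  classical
  set mean : Site d s → ℝ := fun y'' => (((n : ℝ) + 1) ^ d)⁻¹
    * ∑ z'' : Fin d → Fin (n + 1), u (siteOf d ((n + 1) * s) (chart n (windowMap d s y'') z'')) with hmean
  -- exchange: `vol⁻¹Σ_z Σ_{y′} (Σ_{y″} M y′ y″ mean y″) ψ_{y′}(…) = Σ_{y″} (Σ_{y′} T(y,y′) M y′ y″) mean y″`
  have h1 : (((n : ℝ) + 1) ^ d)⁻¹ * ∑ z : Fin d → Fin (n + 1), (∑ y', (∑ y'', Minv y' y'' * mean y'')
        * ψ y' (siteOf d ((n + 1) * s) (chart n (windowMap d s y) z)))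
      = ∑ y'', (∑ y', ((((n : ℝ) + 1) ^ d)⁻¹ * ∑ z : Fin d → Fin (n + 1), ψ y' (siteOf d ((n + 1) * s) (chart n (windowMap d s y) z)))
          * Minv y' y'') * mean y'' := by
    simp only [Finset.mul_sum, Finset.sum_mul]
    -- left: `Σ_z Σ_{y′} Σ_{y″}`, right: `Σ_{y″} Σ_{y′} Σ_z`
    conv_lhs => rw [Finset.sum_comm]
    conv_rhs => rw [Finset.sum_comm]
    refine Finset.sum_congr rfl fun y' _ => ?_
    rw [Finset.sum_comm]
    exact Finset.sum_congr rfl fun y'' _ => Finset.sum_congr rfl fun z _ => by ring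
  rw [h1]
  simp only [hTM, ite_mul, one_mul, zero_mul, Finset.sum_ite_eq, Finset.mem_univ, if_true]
  rfl

variable (ha : 0 ≤ a) {lam κ κ' δ δ₁ c₁ : ℝ} (hκ0 : 0 ≤ κ) (hκ1 : κ ≤ 1)
  (hm : 0 < min 2 a - lam - 2 * d * κ ^ 2 - a * (exp (2 * d * κ) - 1))
  (hκ'0 : 0 ≤ κ') (hκ'1 : κ' ≤ 1) (hm' : 0 < min 2 a - lam - 2 * d * κ' ^ 2 - a * (exp (2 * d * κ') - 1))
  (hδ : 0 < δ) (hδ₁ : δ ≤ δ₁) (h2δ : 2 * δ ≤ κ) (h2κ' : 2 * κ' ≤ δ) (hc₁ : 0 ≤ c₁)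
  (hV : ∀ x, -lam ≤ V x)
  (hMinv : ∀ y' y'' : Site d s, |Minv y' y''| ≤ c₁ * exp (-(δ₁ * ∑ i, (((y' i - y'' i).valMinAbs.natAbs : ℕ) : ℝ))))
  (y₀ : Site d s) (f : Site d ((n + 1) * s) → ℝ)
  (hf : ∀ x, siteOf d s (blk n (windowMap d ((n + 1) * s) x)) ≠ y₀ → f x = 0)
  (hu : ∀ x, ((n : ℝ) + 1) ^ 2 * ∑ μ, (2 * u x - u (x + siteOf d ((n + 1) * s) (e μ)) - u (x - siteOf d ((n + 1) * s) (e μ)))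
      + a / ((n : ℝ) + 1) ^ d * ∑ q ∈ B n (blk n (windowMap d ((n + 1) * s) x)), u (siteOf d ((n + 1) * s) q) + V x * u x = f x)

include ha hκ0 hκ1 hm hδ hδ₁ h2δ hc₁ hV hMinv hf hu in
/-- **THE COARSE COEFFICIENTS `c = M(Q′tu)` DECAY**: if `|M y′ y″| ≤ c₁e^{−δ₁ρ_s(y′,y″)}`, `Hu = f` with `f` supported in the block `y₀`, and
`δ ≤ δ₁`, `2δ ≤ κ`, then `|c y′| ≤ c₁·(m_κ⁻¹e^{2dκ}√((n+1)^{−d}Σf²))·(2∕(1 − e^{−δ}))^d·e^{−δρ_s(y′,y₀)}` (§2 `blockMean_le_of_block_source` ⊛ §1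
`coarse_convolution_le`). [folklore] -/
theorem coeff_le (y' : Site d s) :
    |∑ y'', Minv y' y'' * ((((n : ℝ) + 1) ^ d)⁻¹ * ∑ z'' : Fin d → Fin (n + 1), u (siteOf d ((n + 1) * s) (chart n (windowMap d s y'') z'')))|
      ≤ c₁ * ((min 2 a - lam - 2 * d * κ ^ 2 - a * (exp (2 * d * κ) - 1))⁻¹ * exp (2 * d * κ)
            * √((((n : ℝ) + 1) ^ d)⁻¹ * ∑ x, f x ^ 2))
          * (2 * (1 - exp (-δ))⁻¹) ^ d * exp (-(δ * ∑ i, (((y' i - y₀ i).valMinAbs.natAbs : ℕ) : ℝ))) := by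
  have hB : 0 ≤ (min 2 a - lam - 2 * d * κ ^ 2 - a * (exp (2 * d * κ) - 1))⁻¹ * exp (2 * d * κ)
      * √((((n : ℝ) + 1) ^ d)⁻¹ * ∑ x, f x ^ 2) := by
    have : 0 ≤ (min 2 a - lam - 2 * d * κ ^ 2 - a * (exp (2 * d * κ) - 1))⁻¹ := inv_nonneg.2 hm.le
    positivity
  exact coarse_convolution_le s hδ hδ₁ h2δ hc₁ hB y' y₀ (fun y'' => Minv y' y'')
    (fun y'' => (((n : ℝ) + 1) ^ d)⁻¹ * ∑ z'' : Fin d → Fin (n + 1), u (siteOf d ((n + 1) * s) (chart n (windowMap d s y'') z'')))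
    (fun y'' => hMinv y' y'') (fun y'' => blockMean_le_of_block_source n a s ha hκ0 hκ1 hm V hV y₀ u f hf hu y'')

include ha hκ0 hκ1 hm hκ'0 hκ'1 hm' hδ hδ₁ h2δ h2κ' hc₁ hV hψ hMinv hf hu in
/-- **THE RESPONSE PART IS EXPONENTIALLY LOCAL IN BLOCK `ℓ²`, MESH-FREE**: with `c = M(Q′tu)` as above and `h = Σ_{y′} c y′·ψ_{y′}` (so
`Hh = c∘bt`), for every block `y`: `Σ_z h(σ(chart (wm y) z))² ≤ m_{κ′}⁻²m_κ⁻²c₁²e^{4dκ}e^{4dκ′}K_δ³·e^{−2κ′ρ_s(y,y₀)}·Σ_x f x²`,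
`K_δ = (2∕(1 − e^{−δ}))^d`, `2κ′ ≤ δ` — (137) `blockSq_le_of_decaying_source` on §4 `coeff_le`; the block volume `(n+1)^d` of (137)'s bound cancels
the `(n+1)^{−d}` of the block-RMS source size EXACTLY. [folklore] -/
theorem response_blockSq_le (y : Site d s) :
    ∑ z : Fin d → Fin (n + 1), (∑ y', (∑ y'', Minv y' y''
        * ((((n : ℝ) + 1) ^ d)⁻¹ * ∑ z'' : Fin d → Fin (n + 1), u (siteOf d ((n + 1) * s) (chart n (windowMap d s y'') z''))))
        * ψ y' (siteOf d ((n + 1) * s) (chart n (windowMap d s y) z))) ^ 2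
      ≤ ((min 2 a - lam - 2 * d * κ' ^ 2 - a * (exp (2 * d * κ') - 1))⁻¹) ^ 2
          * ((min 2 a - lam - 2 * d * κ ^ 2 - a * (exp (2 * d * κ) - 1))⁻¹) ^ 2 * c₁ ^ 2 * exp (4 * d * κ) * exp (4 * d * κ')
          * ((2 * (1 - exp (-δ))⁻¹) ^ d) ^ 3
        * exp (-(2 * κ' * ∑ i, (((y i - y₀ i).valMinAbs.natAbs : ℕ) : ℝ))) * ∑ x, f x ^ 2 := by
  classical
  set m := min 2 a - lam - 2 * d * κ ^ 2 - a * (exp (2 * d * κ) - 1) with hm_def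
  set m' := min 2 a - lam - 2 * d * κ' ^ 2 - a * (exp (2 * d * κ') - 1) with hm'_def
  set K : ℝ := (2 * (1 - exp (-δ))⁻¹) ^ d with hK
  set M : ℝ := m⁻¹ * exp (2 * d * κ) * √((((n : ℝ) + 1) ^ d)⁻¹ * ∑ x, f x ^ 2) with hM
  set c : Site d s → ℝ := fun y' => ∑ y'', Minv y' y''
    * ((((n : ℝ) + 1) ^ d)⁻¹ * ∑ z'' : Fin d → Fin (n + 1), u (siteOf d ((n + 1) * s) (chart n (windowMap d s y'') z''))) with hc_def
  have hvol : (0 : ℝ) < ((n : ℝ) + 1) ^ d := by positivity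
  have hF : 0 ≤ ∑ x, f x ^ 2 := Finset.sum_nonneg fun _ _ => sq_nonneg _
  have hcoef : ∀ y', |c y'| ≤ c₁ * M * K * exp (-(δ * ∑ i, (((y' i - y₀ i).valMinAbs.natAbs : ℕ) : ℝ))) :=
    fun y' => coeff_le n a s V Minv u ha hκ0 hκ1 hm hδ hδ₁ h2δ hc₁ hV hMinv y₀ f hf hu y'
  have hH : ∀ x, ((n : ℝ) + 1) ^ 2 * ∑ μ, (2 * (∑ y', c y' * ψ y' x) - (∑ y', c y' * ψ y' (x + siteOf d ((n + 1) * s) (e μ)))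
        - (∑ y', c y' * ψ y' (x - siteOf d ((n + 1) * s) (e μ))))
      + a / ((n : ℝ) + 1) ^ d * ∑ q ∈ B n (blk n (windowMap d ((n + 1) * s) x)), (∑ y', c y' * ψ y' (siteOf d ((n + 1) * s) q))
      + V x * (∑ y', c y' * ψ y' x) = c (siteOf d s (blk n (windowMap d ((n + 1) * s) x))) := fun x => by
    rw [action_sum_smul n a s Finset.univ c ψ V x]
    simp only [hψ, mul_ite, mul_one, mul_zero, Finset.sum_ite_eq, Finset.mem_univ, if_true]
  have h2κ'κ : κ' ≤ 1 := hκ'1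
  have h137 := blockSq_le_of_decaying_source n s a ha hκ'0 h2κ'κ hm' hδ h2κ' V hV y₀ c hcoef (fun x => ∑ y', c y' * ψ y' x) hH y
  refine h137.trans (le_of_eq ?_)
  -- `(c₁MK)²(n+1)^d = c₁²K²m⁻²e^{4dκ}Σf²`
  have hM2 : (c₁ * M * K) ^ 2 * ((n : ℝ) + 1) ^ d = c₁ ^ 2 * K ^ 2 * (m⁻¹) ^ 2 * exp (4 * d * κ) * ∑ x, f x ^ 2 := by
    have hroot : √((((n : ℝ) + 1) ^ d)⁻¹ * ∑ x, f x ^ 2) ^ 2 = (((n : ℝ) + 1) ^ d)⁻¹ * ∑ x, f x ^ 2 :=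
      Real.sq_sqrt (mul_nonneg (inv_nonneg.2 hvol.le) hF)
    have h4 : exp (4 * d * κ) = exp (2 * d * κ) ^ 2 := by rw [sq, ← exp_add]; ring_nf
    rw [hM, mul_pow, mul_pow, mul_pow, mul_pow, hroot, h4]
    field_simp
  have h4' : exp (4 * d * κ') = exp (2 * d * κ') * exp (2 * d * κ') := by rw [← exp_add]; ring_nf
  calc (m'⁻¹) ^ 2 * ((c₁ * M * K) ^ 2 * ((n : ℝ) + 1) ^ d * exp (2 * d * κ') * K) * exp (2 * d * κ')
        * exp (-(2 * κ' * ∑ i, (((y i - y₀ i).valMinAbs.natAbs : ℕ) : ℝ)))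
      = (m'⁻¹) ^ 2 * ((c₁ * M * K) ^ 2 * ((n : ℝ) + 1) ^ d) * (exp (2 * d * κ') * exp (2 * d * κ')) * K
        * exp (-(2 * κ' * ∑ i, (((y i - y₀ i).valMinAbs.natAbs : ℕ) : ℝ))) := by ring
    _ = _ := by rw [hM2, ← h4']; ring

include ha hκ0 hκ1 hm hκ'0 hκ'1 hm' hδ hδ₁ h2δ h2κ' hc₁ hV hψ hMinv hf hu in
/-- **THE FLUCTUATION PART `u − h` IS EXPONENTIALLY LOCAL IN BLOCK `ℓ²`, MESH-FREE**: for every block `y`,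
`Σ_z (u − h)(σ(chart (wm y) z))² ≤ 2·(m_κ⁻²e^{4dκ} + m_{κ′}⁻²m_κ⁻²c₁²e^{4dκ}e^{4dκ′}K_δ³)·e^{−2κ′ρ_s(y,y₀)}·Σ_x f x²` (§2 + §4, `κ′ ≤ κ`). [folklore] -/
theorem fluctuation_blockSq_le (y : Site d s) :
    ∑ z : Fin d → Fin (n + 1), (u (siteOf d ((n + 1) * s) (chart n (windowMap d s y) z)) - ∑ y', (∑ y'', Minv y' y''
        * ((((n : ℝ) + 1) ^ d)⁻¹ * ∑ z'' : Fin d → Fin (n + 1), u (siteOf d ((n + 1) * s) (chart n (windowMap d s y'') z''))))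
        * ψ y' (siteOf d ((n + 1) * s) (chart n (windowMap d s y) z))) ^ 2
      ≤ 2 * (((min 2 a - lam - 2 * d * κ ^ 2 - a * (exp (2 * d * κ) - 1))⁻¹) ^ 2 * exp (4 * d * κ)
          + ((min 2 a - lam - 2 * d * κ' ^ 2 - a * (exp (2 * d * κ') - 1))⁻¹) ^ 2
            * ((min 2 a - lam - 2 * d * κ ^ 2 - a * (exp (2 * d * κ) - 1))⁻¹) ^ 2 * c₁ ^ 2 * exp (4 * d * κ) * exp (4 * d * κ')
            * ((2 * (1 - exp (-δ))⁻¹) ^ d) ^ 3)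
        * exp (-(2 * κ' * ∑ i, (((y i - y₀ i).valMinAbs.natAbs : ℕ) : ℝ))) * ∑ x, f x ^ 2 := by
  classical
  set h : Site d ((n + 1) * s) → ℝ := fun x => ∑ y', (∑ y'', Minv y' y''
    * ((((n : ℝ) + 1) ^ d)⁻¹ * ∑ z'' : Fin d → Fin (n + 1), u (siteOf d ((n + 1) * s) (chart n (windowMap d s y'') z''))))
    * ψ y' x with hh_def
  have hu2 := blockSq_le_of_block_source n a s ha hκ0 hκ1 hm V hV y₀ u f hf hu y
  have hh2 := response_blockSq_le n a s V ψ hψ Minv u ha hκ0 hκ1 hm hκ'0 hκ'1 hm' hδ hδ₁ h2δ h2κ' hc₁ hV hMinv y₀ f hf hu y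
  change ∑ z : Fin d → Fin (n + 1), h (siteOf d ((n + 1) * s) (chart n (windowMap d s y) z)) ^ 2 ≤ _ at hh2
  have hρ0n : 0 ≤ ∑ i, (((y i - y₀ i).valMinAbs.natAbs : ℕ) : ℝ) := Finset.sum_nonneg fun _ _ => Nat.cast_nonneg _
  have hκ'κ : κ' ≤ κ := by linarith
  have hexp : exp (-(2 * κ * ∑ i, (((y i - y₀ i).valMinAbs.natAbs : ℕ) : ℝ)))
      ≤ exp (-(2 * κ' * ∑ i, (((y i - y₀ i).valMinAbs.natAbs : ℕ) : ℝ))) :=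
    exp_le_exp.2 (by nlinarith [mul_le_mul_of_nonneg_right hκ'κ hρ0n])
  have hF : 0 ≤ ∑ x, f x ^ 2 := Finset.sum_nonneg fun _ _ => sq_nonneg _
  -- `(p − q)² ≤ 2p² + 2q²` termwise
  have hsplit : ∑ z : Fin d → Fin (n + 1), (u (siteOf d ((n + 1) * s) (chart n (windowMap d s y) z))
        - h (siteOf d ((n + 1) * s) (chart n (windowMap d s y) z))) ^ 2
      ≤ 2 * ∑ z : Fin d → Fin (n + 1), u (siteOf d ((n + 1) * s) (chart n (windowMap d s y) z)) ^ 2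
        + 2 * ∑ z : Fin d → Fin (n + 1), h (siteOf d ((n + 1) * s) (chart n (windowMap d s y) z)) ^ 2 := by
    rw [Finset.mul_sum, Finset.mul_sum, ← Finset.sum_add_distrib]
    exact Finset.sum_le_sum fun z _ => by
      nlinarith [sq_nonneg (u (siteOf d ((n + 1) * s) (chart n (windowMap d s y) z))
        + h (siteOf d ((n + 1) * s) (chart n (windowMap d s y) z)))]
  refine hsplit.trans ?_
  have hA0 : 0 ≤ ((min 2 a - lam - 2 * d * κ ^ 2 - a * (exp (2 * d * κ) - 1))⁻¹) ^ 2 * exp (4 * d * κ) := by positivity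
  have hu2' : ∑ z : Fin d → Fin (n + 1), u (siteOf d ((n + 1) * s) (chart n (windowMap d s y) z)) ^ 2
      ≤ ((min 2 a - lam - 2 * d * κ ^ 2 - a * (exp (2 * d * κ) - 1))⁻¹) ^ 2 * exp (4 * d * κ)
        * exp (-(2 * κ' * ∑ i, (((y i - y₀ i).valMinAbs.natAbs : ℕ) : ℝ))) * ∑ x, f x ^ 2 :=
    hu2.trans (mul_le_mul_of_nonneg_right (mul_le_mul_of_nonneg_left hexp hA0) hF)
  linarith [hu2', hh2]

end Fluctuation

/-! ## §2. THE END: the fluctuation covariance is exponentially local in block `ℓ²` — given the coarse floor, and unconditionally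
on the two-sided class -/

/-- **A COARSE FLOOR MAKES THE SCHUR COMPLEMENT INVERTIBLE**: `γΣg² ≤ ⟨g, Tg⟩` for all `g` with `γ > 0` ⟹ `T.mulVec` injective ⟹
`IsUnit (det T)` (Mathlib `Matrix.mulVec_injective_iff_isUnit`); `T` any real matrix on a finite index type. [folklore] -/
theorem det_isUnit_of_floor {ι : Type*} [Fintype ι] [DecidableEq ι] (T : Matrix ι ι ℝ) {γ : ℝ} (hγ : 0 < γ)
    (hfloor : ∀ g : ι → ℝ, γ * ∑ y, g y ^ 2 ≤ ∑ y, g y * ∑ y', T y y' * g y') : IsUnit T.det := by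
  have hinj : Function.Injective T.mulVec := by
    intro g₁ g₂ hg
    have hg0 : T.mulVec (g₁ - g₂) = 0 := by rw [Matrix.mulVec_sub, hg, sub_self]
    have hfl := hfloor (g₁ - g₂)
    have hform : ∑ y, (g₁ - g₂) y * ∑ y', T y y' * (g₁ - g₂) y' = ∑ y, (g₁ - g₂) y * T.mulVec (g₁ - g₂) y := by
      simp only [Matrix.mulVec, dotProduct]
    rw [hform, hg0] at hfl
    simp only [Pi.zero_apply, mul_zero, Finset.sum_const_zero] at hfl
    have hS : ∑ y, (g₁ - g₂) y ^ 2 ≤ 0 := not_lt.1 fun hne => (not_le.2 (mul_pos hγ hne)) hfl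
    funext y
    have hy : (g₁ - g₂) y ^ 2 ≤ 0 := (Finset.single_le_sum (fun y _ => sq_nonneg ((g₁ - g₂) y)) (Finset.mem_univ y)).trans hS
    have : (g₁ - g₂) y = 0 := by nlinarith [sq_nonneg ((g₁ - g₂) y)]
    simpa [sub_eq_zero] using this
  exact (Matrix.isUnit_iff_isUnit_det T).1 (Matrix.mulVec_injective_iff_isUnit.1 hinj)

/-- **THE FLUCTUATION COVARIANCE `C = H⁻¹ − H⁻¹Q′t*T⁻¹Q′tH⁻¹` IS EXPONENTIALLY LOCAL BLOCK-TO-BLOCK — GIVEN THE COARSE FLOOR.**  Fix `d`,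
`a ≥ 0`, `λ < min(2,a)` and a floor `γ > 0`.  THERE ARE `C, δ > 0` (functions of these only) such that for ALL `n, s`, ALL `V ≥ −λ`, ALL block
columns `ψ` (`Hψ_{y′} = 𝟙[bt · = y′]`) whose Schur complement `T(y,y′) = (n+1)^{−d}Σ_z ψ_{y′}(σ(chart (wm y) z))` has the floor `γΣg² ≤ ⟨g,Tg⟩`,
every block `y₀` and every `u, f` with `Hu = f`, `f` supported in the block `y₀`: with `T⁻¹` Mathlib's inverse of `Matrix.of T` and
`h := Σ_{y′}(Σ_{y″}T⁻¹(y′,y″)·(n+1)^{−d}Σ_{z}u(σ(chart (wm y″) z)))·ψ_{y′}` (`= H⁻¹Q′t*T⁻¹Q′t u`, so `u − h = Cf`):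
(i) `Σ_z u(σ(chart (wm y) z))² ≤ C·e^{−2δρ_s(y,y₀)}·Σf²` (the unconstrained propagator `H⁻¹`, block to block);
(ii) `(n+1)^{−d}Σ_z (u − h)(σ(chart (wm y) z)) = 0` (the fluctuation part has zero block means: `Q′tC = 0`);
(iii) `Σ_z (u − h)(σ(chart (wm y) z))² ≤ C·e^{−2δρ_s(y,y₀)}·Σf²` (the fluctuation covariance, block to block) — for EVERY block `y`.
(131) `exists_rate` ∘ (134) `schur_inverse_decay` ∘ §1. [folklore] -/
theorem covariance_local_of_floor (a : ℝ) (ha : 0 ≤ a) {lam γ : ℝ} (hm0 : 0 < min 2 a - lam) (hγ : 0 < γ) :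
    ∃ C δ : ℝ, 0 < C ∧ 0 < δ ∧ ∀ (n s : ℕ) [NeZero s] (V : Site d ((n + 1) * s) → ℝ), (∀ x, -lam ≤ V x) →
      ∀ ψ : Site d s → Site d ((n + 1) * s) → ℝ,
      (∀ y' x, ((n : ℝ) + 1) ^ 2 * ∑ μ, (2 * ψ y' x - ψ y' (x + siteOf d ((n + 1) * s) (e μ)) - ψ y' (x - siteOf d ((n + 1) * s) (e μ)))
        + a / ((n : ℝ) + 1) ^ d * ∑ q ∈ B n (blk n (windowMap d ((n + 1) * s) x)), ψ y' (siteOf d ((n + 1) * s) q) + V x * ψ y' x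
        = if siteOf d s (blk n (windowMap d ((n + 1) * s) x)) = y' then 1 else 0) →
      (∀ g : Site d s → ℝ, γ * ∑ y, g y ^ 2
        ≤ ∑ y, g y * ∑ y', ((((n : ℝ) + 1) ^ d)⁻¹ * ∑ z : Fin d → Fin (n + 1), ψ y' (siteOf d ((n + 1) * s) (chart n (windowMap d s y) z))) * g y') →
      ∀ (y₀ : Site d s) (u f : Site d ((n + 1) * s) → ℝ), (∀ x, siteOf d s (blk n (windowMap d ((n + 1) * s) x)) ≠ y₀ → f x = 0) →
      (∀ x, ((n : ℝ) + 1) ^ 2 * ∑ μ, (2 * u x - u (x + siteOf d ((n + 1) * s) (e μ)) - u (x - siteOf d ((n + 1) * s) (e μ)))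
        + a / ((n : ℝ) + 1) ^ d * ∑ q ∈ B n (blk n (windowMap d ((n + 1) * s) x)), u (siteOf d ((n + 1) * s) q) + V x * u x = f x) →
        (∀ y : Site d s, ∑ z : Fin d → Fin (n + 1), u (siteOf d ((n + 1) * s) (chart n (windowMap d s y) z)) ^ 2
          ≤ C * exp (-(2 * δ * ∑ i, (((y i - y₀ i).valMinAbs.natAbs : ℕ) : ℝ))) * ∑ x, f x ^ 2) ∧
        (∀ y : Site d s, (((n : ℝ) + 1) ^ d)⁻¹ * ∑ z : Fin d → Fin (n + 1), (u (siteOf d ((n + 1) * s) (chart n (windowMap d s y) z))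
          - ∑ y', (∑ y'', (Matrix.of fun yy y'' : Site d s =>
              (((n : ℝ) + 1) ^ d)⁻¹ * ∑ z : Fin d → Fin (n + 1), ψ y'' (siteOf d ((n + 1) * s) (chart n (windowMap d s yy) z)))⁻¹ y' y''
            * ((((n : ℝ) + 1) ^ d)⁻¹ * ∑ z'' : Fin d → Fin (n + 1), u (siteOf d ((n + 1) * s) (chart n (windowMap d s y'') z''))))
            * ψ y' (siteOf d ((n + 1) * s) (chart n (windowMap d s y) z))) = 0) ∧
        (∀ y : Site d s, ∑ z : Fin d → Fin (n + 1), (u (siteOf d ((n + 1) * s) (chart n (windowMap d s y) z))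
          - ∑ y', (∑ y'', (Matrix.of fun yy y'' : Site d s =>
              (((n : ℝ) + 1) ^ d)⁻¹ * ∑ z : Fin d → Fin (n + 1), ψ y'' (siteOf d ((n + 1) * s) (chart n (windowMap d s yy) z)))⁻¹ y' y''
            * ((((n : ℝ) + 1) ^ d)⁻¹ * ∑ z'' : Fin d → Fin (n + 1), u (siteOf d ((n + 1) * s) (chart n (windowMap d s y'') z''))))
            * ψ y' (siteOf d ((n + 1) * s) (chart n (windowMap d s y) z))) ^ 2
          ≤ C * exp (-(2 * δ * ∑ i, (((y i - y₀ i).valMinAbs.natAbs : ℕ) : ℝ))) * ∑ x, f x ^ 2) := by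
  classical
  have hd : (0 : ℝ) ≤ d := Nat.cast_nonneg d
  -- the rates: `κ₀` from (131), `(c₁, δ₁)` from (134) at the floor `γ`, `δ = min(δ₁, κ₀∕2)`, `κ′ = δ∕2`
  obtain ⟨κ₀, hκ₀0, hκ₀1, hκ₀m⟩ := exists_rate (d := d) a ha hm0
  have hmκ₀ : 0 < min 2 a - lam - 2 * d * κ₀ ^ 2 - a * (exp (2 * d * κ₀) - 1) := by linarith
  obtain ⟨c₁, δ₁, hc₁, hδ₁, H134⟩ := schur_inverse_decay (d := d) a ha hκ₀0 hκ₀1 hmκ₀ hγ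
  set δ : ℝ := min δ₁ (κ₀ / 2) with hδ_def
  have hδ0 : 0 < δ := lt_min hδ₁ (by linarith)
  have hδδ₁ : δ ≤ δ₁ := min_le_left _ _
  have h2δ : 2 * δ ≤ κ₀ := by have := min_le_right δ₁ (κ₀ / 2); rw [← hδ_def] at this; linarith
  set κ' : ℝ := δ / 2 with hκ'_def
  have hκ'0 : 0 < κ' := by rw [hκ'_def]; linarith
  have h2κ' : 2 * κ' ≤ δ := by rw [hκ'_def]; linarith
  have hκ'κ₀ : κ' ≤ κ₀ := by linarith
  have hκ'1 : κ' ≤ 1 := hκ'κ₀.trans hκ₀1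
  have hmκ'le : (min 2 a - lam) / 2 ≤ min 2 a - lam - 2 * d * κ' ^ 2 - a * (exp (2 * d * κ') - 1) :=
    hκ₀m.trans (rate_mono (d := d) a ha hκ'0.le hκ'κ₀)
  have hmκ' : 0 < min 2 a - lam - 2 * d * κ' ^ 2 - a * (exp (2 * d * κ') - 1) := by linarith
  set K : ℝ := (2 * (1 - exp (-δ))⁻¹) ^ d with hK
  have hK0 : 0 ≤ K := pow_nonneg (mul_nonneg zero_le_two (inv_nonneg.2 (sub_nonneg.2 (exp_le_one_iff.2 (by linarith))))) d
  have hK3 : 0 ≤ K ^ 3 := pow_nonneg hK0 3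
  -- the constant: twice the sum of the two lemmas' constants, plus one
  refine ⟨2 * (((min 2 a - lam - 2 * d * κ₀ ^ 2 - a * (exp (2 * d * κ₀) - 1))⁻¹) ^ 2 * exp (4 * d * κ₀)
      + ((min 2 a - lam - 2 * d * κ' ^ 2 - a * (exp (2 * d * κ') - 1))⁻¹) ^ 2
        * ((min 2 a - lam - 2 * d * κ₀ ^ 2 - a * (exp (2 * d * κ₀) - 1))⁻¹) ^ 2 * c₁ ^ 2 * exp (4 * d * κ₀) * exp (4 * d * κ')
        * K ^ 3) + 1, κ', by positivity, hκ'0, ?_⟩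
  intro n s _ V hV ψ hψ hfloor y₀ u f hf hu
  set T : Matrix (Site d s) (Site d s) ℝ := Matrix.of fun yy y'' : Site d s =>
    (((n : ℝ) + 1) ^ d)⁻¹ * ∑ z : Fin d → Fin (n + 1), ψ y'' (siteOf d ((n + 1) * s) (chart n (windowMap d s yy) z)) with hT_def
  have hF : 0 ≤ ∑ x, f x ^ 2 := Finset.sum_nonneg fun _ _ => sq_nonneg _
  have hA0 : 0 ≤ ((min 2 a - lam - 2 * d * κ₀ ^ 2 - a * (exp (2 * d * κ₀) - 1))⁻¹) ^ 2 * exp (4 * d * κ₀) := by positivity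
  have hB0 : 0 ≤ ((min 2 a - lam - 2 * d * κ' ^ 2 - a * (exp (2 * d * κ') - 1))⁻¹) ^ 2
      * ((min 2 a - lam - 2 * d * κ₀ ^ 2 - a * (exp (2 * d * κ₀) - 1))⁻¹) ^ 2 * c₁ ^ 2 * exp (4 * d * κ₀) * exp (4 * d * κ')
      * K ^ 3 := by positivity
  -- invertibility of `T` and the right-inverse display
  have hunit : IsUnit T.det := det_isUnit_of_floor T hγ fun g => by simpa only [hT_def, Matrix.of_apply] using hfloor g
  have hTM : ∀ y y'' : Site d s, ∑ y', ((((n : ℝ) + 1) ^ d)⁻¹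
        * ∑ z : Fin d → Fin (n + 1), ψ y' (siteOf d ((n + 1) * s) (chart n (windowMap d s y) z))) * T⁻¹ y' y''
      = if y = y'' then 1 else 0 := by
    intro y y''
    have h1 : (T * T⁻¹) y y'' = if y = y'' then 1 else 0 := by rw [Matrix.mul_nonsing_inv T hunit, Matrix.one_apply]
    rw [Matrix.mul_apply] at h1
    simpa only [hT_def, Matrix.of_apply] using h1
  have hMinv : ∀ y' y'' : Site d s, |T⁻¹ y' y''| ≤ c₁ * exp (-(δ₁ * ∑ i, (((y' i - y'' i).valMinAbs.natAbs : ℕ) : ℝ))) :=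
    fun y' y'' => H134 n s V hV ψ hψ hfloor y' y''
  refine ⟨fun y => ?_, fun y => ?_, fun y => ?_⟩
  · -- (i) the unconstrained propagator
    have hu2 := blockSq_le_of_block_source n a s ha hκ₀0.le hκ₀1 hmκ₀ V hV y₀ u f hf hu y
    have hρ0n : 0 ≤ ∑ i, (((y i - y₀ i).valMinAbs.natAbs : ℕ) : ℝ) := Finset.sum_nonneg fun _ _ => Nat.cast_nonneg _
    have hexp : exp (-(2 * κ₀ * ∑ i, (((y i - y₀ i).valMinAbs.natAbs : ℕ) : ℝ)))
        ≤ exp (-(2 * κ' * ∑ i, (((y i - y₀ i).valMinAbs.natAbs : ℕ) : ℝ))) :=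
      exp_le_exp.2 (by nlinarith [mul_le_mul_of_nonneg_right hκ'κ₀ hρ0n])
    refine hu2.trans ?_
    have hE0 : 0 ≤ exp (-(2 * κ' * ∑ i, (((y i - y₀ i).valMinAbs.natAbs : ℕ) : ℝ))) := (exp_pos _).le
    have hc1 : ((min 2 a - lam - 2 * d * κ₀ ^ 2 - a * (exp (2 * d * κ₀) - 1))⁻¹) ^ 2 * exp (4 * d * κ₀)
        ≤ 2 * (((min 2 a - lam - 2 * d * κ₀ ^ 2 - a * (exp (2 * d * κ₀) - 1))⁻¹) ^ 2 * exp (4 * d * κ₀)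
          + ((min 2 a - lam - 2 * d * κ' ^ 2 - a * (exp (2 * d * κ') - 1))⁻¹) ^ 2
            * ((min 2 a - lam - 2 * d * κ₀ ^ 2 - a * (exp (2 * d * κ₀) - 1))⁻¹) ^ 2 * c₁ ^ 2 * exp (4 * d * κ₀) * exp (4 * d * κ')
            * K ^ 3) + 1 := by linarith
    calc ((min 2 a - lam - 2 * d * κ₀ ^ 2 - a * (exp (2 * d * κ₀) - 1))⁻¹) ^ 2 * exp (4 * d * κ₀)
          * exp (-(2 * κ₀ * ∑ i, (((y i - y₀ i).valMinAbs.natAbs : ℕ) : ℝ))) * ∑ x, f x ^ 2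
        ≤ ((min 2 a - lam - 2 * d * κ₀ ^ 2 - a * (exp (2 * d * κ₀) - 1))⁻¹) ^ 2 * exp (4 * d * κ₀)
          * exp (-(2 * κ' * ∑ i, (((y i - y₀ i).valMinAbs.natAbs : ℕ) : ℝ))) * ∑ x, f x ^ 2 :=
          mul_le_mul_of_nonneg_right (mul_le_mul_of_nonneg_left hexp (by positivity)) hF
      _ ≤ _ := mul_le_mul_of_nonneg_right (mul_le_mul_of_nonneg_right hc1 hE0) hF
  · -- (ii) zero block means of the fluctuation part
    rw [Finset.sum_sub_distrib, mul_sub, sub_eq_zero]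
    exact (blockMean_response_eq n s ψ (fun y' y'' => T⁻¹ y' y'') u hTM y).symm
  · -- (iii) the fluctuation covariance
    have h := fluctuation_blockSq_le n a s V ψ hψ (fun y' y'' => T⁻¹ y' y'') u ha hκ₀0.le hκ₀1 hmκ₀ hκ'0.le hκ'1 hmκ' hδ0 hδδ₁
      h2δ h2κ' hc₁.le hV hMinv y₀ f hf hu y
    refine h.trans ?_
    have hE0 : 0 ≤ exp (-(2 * κ' * ∑ i, (((y i - y₀ i).valMinAbs.natAbs : ℕ) : ℝ))) := (exp_pos _).le
    exact mul_le_mul_of_nonneg_right (mul_le_mul_of_nonneg_right (by linarith) hE0) hF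

/-- **HEADLINE — THE FLUCTUATION COVARIANCE OF THE TORUS ROAD IS EXPONENTIALLY LOCAL BLOCK-TO-BLOCK, UNCONDITIONALLY ON THE TWO-SIDED
CLASS**: for `a > 0`, `λ < min(2,a)`, `Λ ≥ 0` there are `C, δ > 0` depending on `(d, a, λ, Λ)` ONLY such that (i)–(iii) of
`covariance_local_of_floor` hold for ALL `n, s`, ALL `−λ ≤ V ≤ Λ`, ALL block columns `ψ`, every block `y₀`, every `Hu = f` with `f` supported
in the block `y₀` — the floor is (135) `coarse_floor` (`γ = 1∕(36^d(4d + a + Λ))`). [folklore] -/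
theorem covariance_local (a : ℝ) (ha : 0 < a) {lam Lam : ℝ} (hm0 : 0 < min 2 a - lam) (hLam : 0 ≤ Lam) :
    ∃ C δ : ℝ, 0 < C ∧ 0 < δ ∧ ∀ (n s : ℕ) [NeZero s] (V : Site d ((n + 1) * s) → ℝ), (∀ x, -lam ≤ V x) → (∀ x, V x ≤ Lam) →
      ∀ ψ : Site d s → Site d ((n + 1) * s) → ℝ,
      (∀ y' x, ((n : ℝ) + 1) ^ 2 * ∑ μ, (2 * ψ y' x - ψ y' (x + siteOf d ((n + 1) * s) (e μ)) - ψ y' (x - siteOf d ((n + 1) * s) (e μ)))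
        + a / ((n : ℝ) + 1) ^ d * ∑ q ∈ B n (blk n (windowMap d ((n + 1) * s) x)), ψ y' (siteOf d ((n + 1) * s) q) + V x * ψ y' x
        = if siteOf d s (blk n (windowMap d ((n + 1) * s) x)) = y' then 1 else 0) →
      ∀ (y₀ : Site d s) (u f : Site d ((n + 1) * s) → ℝ), (∀ x, siteOf d s (blk n (windowMap d ((n + 1) * s) x)) ≠ y₀ → f x = 0) →
      (∀ x, ((n : ℝ) + 1) ^ 2 * ∑ μ, (2 * u x - u (x + siteOf d ((n + 1) * s) (e μ)) - u (x - siteOf d ((n + 1) * s) (e μ)))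
        + a / ((n : ℝ) + 1) ^ d * ∑ q ∈ B n (blk n (windowMap d ((n + 1) * s) x)), u (siteOf d ((n + 1) * s) q) + V x * u x = f x) →
        (∀ y : Site d s, ∑ z : Fin d → Fin (n + 1), u (siteOf d ((n + 1) * s) (chart n (windowMap d s y) z)) ^ 2
          ≤ C * exp (-(2 * δ * ∑ i, (((y i - y₀ i).valMinAbs.natAbs : ℕ) : ℝ))) * ∑ x, f x ^ 2) ∧
        (∀ y : Site d s, (((n : ℝ) + 1) ^ d)⁻¹ * ∑ z : Fin d → Fin (n + 1), (u (siteOf d ((n + 1) * s) (chart n (windowMap d s y) z))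
          - ∑ y', (∑ y'', (Matrix.of fun yy y'' : Site d s =>
              (((n : ℝ) + 1) ^ d)⁻¹ * ∑ z : Fin d → Fin (n + 1), ψ y'' (siteOf d ((n + 1) * s) (chart n (windowMap d s yy) z)))⁻¹ y' y''
            * ((((n : ℝ) + 1) ^ d)⁻¹ * ∑ z'' : Fin d → Fin (n + 1), u (siteOf d ((n + 1) * s) (chart n (windowMap d s y'') z''))))
            * ψ y' (siteOf d ((n + 1) * s) (chart n (windowMap d s y) z))) = 0) ∧
        (∀ y : Site d s, ∑ z : Fin d → Fin (n + 1), (u (siteOf d ((n + 1) * s) (chart n (windowMap d s y) z))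
          - ∑ y', (∑ y'', (Matrix.of fun yy y'' : Site d s =>
              (((n : ℝ) + 1) ^ d)⁻¹ * ∑ z : Fin d → Fin (n + 1), ψ y'' (siteOf d ((n + 1) * s) (chart n (windowMap d s yy) z)))⁻¹ y' y''
            * ((((n : ℝ) + 1) ^ d)⁻¹ * ∑ z'' : Fin d → Fin (n + 1), u (siteOf d ((n + 1) * s) (chart n (windowMap d s y'') z''))))
            * ψ y' (siteOf d ((n + 1) * s) (chart n (windowMap d s y) z))) ^ 2
          ≤ C * exp (-(2 * δ * ∑ i, (((y i - y₀ i).valMinAbs.natAbs : ℕ) : ℝ))) * ∑ x, f x ^ 2) := by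
  have hd : (0 : ℝ) ≤ d := Nat.cast_nonneg d
  have hγ : 0 < 1 / ((36 : ℝ) ^ d * (4 * d + a + Lam)) := by positivity
  obtain ⟨C, δ, hC, hδ, H⟩ := covariance_local_of_floor (d := d) a ha.le hm0 hγ
  exact ⟨C, δ, hC, hδ, fun n s _ V hV hV' ψ hψ y₀ u f hf hu =>
    H n s V hV ψ hψ (coarse_floor n a s ha (by linarith) hLam V hV hV' ψ hψ) y₀ u f hf hu⟩

/-! ## §3. Toy -/

/-- Toy (`d = 0`, `a = 1`, `λ = 0`, `Λ = 0`): the headline's hypotheses are inhabited, so the constants exist. -/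
example : ∃ C δ : ℝ, 0 < C ∧ 0 < δ :=
  let ⟨C, δ, hC, hδ, _⟩ := covariance_local (d := 0) 1 one_pos (lam := 0) (Lam := 0) (by norm_num) le_rfl; ⟨C, δ, hC, hδ⟩

end Summit.QuantumFields.BalabanUV.T4Continuum.NE7b.SupTorusCovarianceLocality
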